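import Mathlib

/-!
# Tier7/Line3/AdicValuationInvariant — a field automorphism fixing the prime preserves the adic valuation
(seat t7-x1, gen 4; the algebraic clause `hσ` of AdicCompletionInvolution, discharged from the number-field datum)

LINE 3 (t7-plan-3), version (ii). AdicCompletionInvolution builds the isometric involution of `E_w` from the algebraic
clause `hσ : ∀ x, w.valuation E (σ x) = w.valuation E x`. This module proves that clause:

* `intValuation_apply`: over any Dedekind domain `R`, a ring automorphism `τ` that FIXES the prime `w.asIdeal`
  (`τ x ∈ 𝔭 ↔ x ∈ 𝔭`) fixes its powers (`mem_pow_iff`, via `Ideal.map_comap_of_equiv` and `Ideal.map_pow`) and hence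
  preserves `w.intValuation` — the valuation is `exp (−multiplicity 𝔭 (x))` (`intValuation_eq_exp_neg_multiplicity`) and
  the multiplicities agree because `𝔭^n ∣ (τ x) ↔ 𝔭^n ∣ (x)` for every `n` (`emultiplicity_eq_emultiplicity_iff`);
* `valuation_apply`: for a number field `E`, a ring endomorphism `σ : E →+* E` restricting to such a `τ` on `𝓞 E`
  preserves `w.valuation E` (fractions `r / s`, `valuation_of_mk'`);
* `restrict_mem_iff`: for `E / K` number fields and `σ ∈ Gal(E/K)`, the restriction `galRestrict (𝓞 K) K E (𝓞 E) σ`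
  fixes `w.asIdeal` as soon as `w` is the ONLY prime of `E` above the prime `v` of `K` below it (`Ideal.comap` of the
  prime along the `𝓞 K`-linear automorphism is a prime with the same prime below, hence equal to it);
* `valuation_galRestrict`: the assembled clause `∀ x, w.valuation E (σ x) = w.valuation E x` under that uniqueness.

DICTIONARY (in words): `K = E⁺`, `E` the CM field, `σ` its Galois involution, `v = v₁` INERT in `E/E⁺` — which is exactly
the uniqueness hypothesis `huniq` (one prime of `E` above `v₁`; ramified would do as well). With AdicCompletionInvolution
this puts the clause «`σ` the isometric involution of `E_{v₁}`» of the [W] column in the kernel down to the number-field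
datum `(E/E⁺, σ, v₁, w)`. Nothing here is about (N), (P), the real `X`, or HC_CM; §8(d): NO. Blind lane: Mathlib only;
no sorry; axioms ⊆ {propext, Classical.choice, Quot.sound}.
-/

namespace Summit.Ventures.HodgeRepro2.Tier7.Line3.AdicValuationInvariant

open IsDedekindDomain IsDedekindDomain.HeightOneSpectrum NumberField
open scoped NumberField WithZero

/-! ## Integral level: an automorphism fixing the prime preserves the integral valuation -/

section integral

variable {R : Type*} [CommRing R] [IsDedekindDomain R] (w : HeightOneSpectrum R) (τ : R ≃+* R)

omit [IsDedekindDomain R] in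
/-- an automorphism fixing the prime `w.asIdeal` maps it onto itself. -/
theorem map_asIdeal_eq (hP : ∀ x, τ x ∈ w.asIdeal ↔ x ∈ w.asIdeal) :
    Ideal.map (τ : R →+* R) w.asIdeal = w.asIdeal := by
  rw [Ideal.map_comap_of_equiv]
  ext y
  rw [Ideal.mem_comap]
  have h := hP (τ.symm y)
  rw [RingEquiv.apply_symm_apply] at h
  exact h.symm

omit [IsDedekindDomain R] in
/-- an automorphism fixing the prime fixes its powers. -/
theorem mem_pow_iff (hP : ∀ x, τ x ∈ w.asIdeal ↔ x ∈ w.asIdeal) (n : ℕ) (x : R) :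
    τ x ∈ w.asIdeal ^ n ↔ x ∈ w.asIdeal ^ n := by
  have hmapn : Ideal.map (τ : R →+* R) (w.asIdeal ^ n) = w.asIdeal ^ n := by
    rw [Ideal.map_pow, map_asIdeal_eq w τ hP]
  constructor
  · intro h
    have h' : τ x ∈ Ideal.map (τ : R →+* R) (w.asIdeal ^ n) := hmapn.symm ▸ h
    rw [Ideal.map_comap_of_equiv, Ideal.mem_comap, RingEquiv.symm_apply_apply] at h'
    exact h'
  · intro h
    rw [← hmapn, Ideal.map_comap_of_equiv, Ideal.mem_comap, RingEquiv.symm_apply_apply]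
    exact h

/-- **an automorphism fixing the prime preserves the integral `w`-adic valuation.** -/
theorem intValuation_apply (hP : ∀ x, τ x ∈ w.asIdeal ↔ x ∈ w.asIdeal) (x : R) :
    w.intValuation (τ x) = w.intValuation x := by
  rcases eq_or_ne x 0 with rfl | hx
  · simp
  have hτx : τ x ≠ 0 := fun h => hx (τ.injective (by rw [h, map_zero]))
  rw [intValuation_eq_exp_neg_multiplicity w hτx, intValuation_eq_exp_neg_multiplicity w hx]
  congr 3
  apply multiplicity_eq_of_emultiplicity_eq
  rw [emultiplicity_eq_emultiplicity_iff]
  intro n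
  rw [Ideal.dvd_iff_le, Ideal.dvd_iff_le, Ideal.span_singleton_le_iff_mem, Ideal.span_singleton_le_iff_mem]
  exact mem_pow_iff w τ hP n x

end integral

/-! ## Field level: the valuation of the number field -/

section field

variable {E : Type*} [Field E] [NumberField E] (w : HeightOneSpectrum (𝓞 E)) (σ : E →+* E) (τ : 𝓞 E ≃+* 𝓞 E)

/-- **a ring endomorphism of `E` restricting to an automorphism of `𝓞 E` that fixes the prime preserves the `w`-adic
valuation of `E`.** -/
theorem valuation_apply (hτ : ∀ x : 𝓞 E, σ (algebraMap (𝓞 E) E x) = algebraMap (𝓞 E) E (τ x))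
    (hP : ∀ x, τ x ∈ w.asIdeal ↔ x ∈ w.asIdeal) (x : E) :
    w.valuation E (σ x) = w.valuation E x := by
  obtain ⟨⟨r, s⟩, rfl⟩ := IsLocalization.mk'_surjective (nonZeroDivisors (𝓞 E)) x
  have hs : τ s ∈ nonZeroDivisors (𝓞 E) := by
    rw [mem_nonZeroDivisors_iff_ne_zero]
    exact fun h => nonZeroDivisors.coe_ne_zero s (τ.injective (by rw [h, map_zero]))
  have hσ : σ (IsLocalization.mk' E r s) = IsLocalization.mk' E (τ r) ⟨τ s, hs⟩ := by
    rw [IsFractionRing.mk'_eq_div, IsFractionRing.mk'_eq_div, map_div₀, hτ, hτ]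
  rw [hσ, valuation_of_mk', valuation_of_mk', intValuation_apply w τ hP, intValuation_apply w τ hP]

end field

/-! ## Galois level: the restriction of `σ ∈ Gal(E/K)` fixes the unique prime above `v` -/

section galois

variable {K E : Type*} [Field K] [NumberField K] [Field E] [NumberField E] [Algebra K E]
  (w : HeightOneSpectrum (𝓞 E)) (σ : E ≃ₐ[K] E)

/-- the restriction of `σ` to the rings of integers, as a ring automorphism. -/
noncomputable def restrict : 𝓞 E ≃+* 𝓞 E := (galRestrict (𝓞 K) K E (𝓞 E) σ).toRingEquiv

/-- `restrict` is the restriction of `σ`. -/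
theorem algebraMap_restrict (x : 𝓞 E) :
    (σ : E →+* E) (algebraMap (𝓞 E) E x) = algebraMap (𝓞 E) E (restrict σ x) :=
  (algebraMap_galRestrict_apply (𝓞 K) σ x).symm

/-- `restrict` is `𝓞 K`-linear: it fixes the image of `𝓞 K`. -/
theorem restrict_algebraMap (a : 𝓞 K) : restrict σ (algebraMap (𝓞 K) (𝓞 E) a) = algebraMap (𝓞 K) (𝓞 E) a :=
  (galRestrict (𝓞 K) K E (𝓞 E) σ).commutes a

/-- the prime below `Ideal.comap (restrict σ) w.asIdeal` is the prime below `w.asIdeal`. -/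
theorem comap_restrict_comap :
    (Ideal.comap (restrict σ) w.asIdeal).comap (algebraMap (𝓞 K) (𝓞 E)) =
      w.asIdeal.comap (algebraMap (𝓞 K) (𝓞 E)) := by
  ext a
  rw [Ideal.mem_comap, Ideal.mem_comap, Ideal.mem_comap, restrict_algebraMap]

/-- the pull-back of `w` along `restrict σ`, as a height-one prime. -/
noncomputable def pullback : HeightOneSpectrum (𝓞 E) where
  asIdeal := Ideal.comap (restrict σ) w.asIdeal
  isPrime := Ideal.comap_isPrime _ _
  ne_bot := by
    intro h
    apply w.ne_bot
    rw [← Ideal.map_symm] at h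
    exact (Ideal.map_eq_bot_iff_of_injective (restrict σ).symm.injective).1 h

/-- **the restriction of `σ ∈ Gal(E/K)` fixes `w.asIdeal` when `w` is the only prime above the prime `v` of `K`
below it.** -/
theorem restrict_mem_iff (v : HeightOneSpectrum (𝓞 K))
    (hw : w.asIdeal.comap (algebraMap (𝓞 K) (𝓞 E)) = v.asIdeal)
    (huniq : ∀ w' : HeightOneSpectrum (𝓞 E), w'.asIdeal.comap (algebraMap (𝓞 K) (𝓞 E)) = v.asIdeal → w' = w)
    (x : 𝓞 E) : restrict σ x ∈ w.asIdeal ↔ x ∈ w.asIdeal := by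
  have hQ : pullback w σ = w := huniq _ (by rw [← hw]; exact comap_restrict_comap w σ)
  have hx : x ∈ (pullback w σ).asIdeal ↔ x ∈ w.asIdeal := by rw [hQ]
  rw [← hx]
  exact (Ideal.mem_comap (f := restrict σ)).symm

/-- **the Galois automorphism preserves the `w`-adic valuation when `w` is the only prime above `v`** — the clause
`hσ` of AdicCompletionInvolution, from the number-field datum. -/
theorem valuation_galRestrict (v : HeightOneSpectrum (𝓞 K))
    (hw : w.asIdeal.comap (algebraMap (𝓞 K) (𝓞 E)) = v.asIdeal)
    (huniq : ∀ w' : HeightOneSpectrum (𝓞 E), w'.asIdeal.comap (algebraMap (𝓞 K) (𝓞 E)) = v.asIdeal → w' = w)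
    (x : E) : w.valuation E ((σ : E →+* E) x) = w.valuation E x :=
  valuation_apply w (σ : E →+* E) (restrict σ) (algebraMap_restrict σ) (restrict_mem_iff w σ v hw huniq) x

end galois

end Summit.Ventures.HodgeRepro2.Tier7.Line3.AdicValuationInvariant
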